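import Summits.AtomisticToContinuum.Crystallization.Theorems.PerronTransitivityUniformBindingRigidityCohesionE

/-!
# Cohesion of uniformly bound Lennard-Jones configurations, VI: no uniformly bound slabs

Helper file (`--supports stmt-AtomisticToContinuum-15099`) of the stub `stub_cohesion` of the line
`registered` (skeleton `Cruxes/UniformBindingRigidity/Lines/birth.lean`) of the crux
`Summit.AtomisticToContinuum.Crystallization.Theses.PerronTransitivity.UniformBindingRigidity`
(item stmt-AtomisticToContinuum-15099), concluding part V (`…CohesionE.lean`, the window inequality).

`noSlabBinding` — **the thin case of `(NHB)`**: a `1/4`-separated `Y ⊆ ℝ³` with `0 ∈ Y` contained in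
a slab `{−T ≤ ⟪q, u⟫ ≤ 0}` (`‖u‖ = 1`) has a site with Lennard-Jones site sum `> 2e*`.  Proof: if all
sites were `≤ 2e*`, the window inequality of part V at scale `D = max 1 (21846/|V_LJ(T+2)|)` gives
`#W_{L−D} ≤ (1 − κ)·#W_L` with `κ = |V_LJ(T+2)|/1398102 ∈ (0, 1)` for every `L`, hence
`(1−κ)^k · #W_{D+kD} ≥ #W_D ≥ 1` for all `k` (`0 ∈ W_D`), while windows obey the cubic packing bound
`#W_L ≤ (8(L+T) + 1)³ ≤ A³(k+1)³` (`card_window_le`, tree: `HullBulkOptimal.ncard_ball_le`) and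
`(k+1)³(1−κ)^k → 0`.

So in the half-space reduction of part IV only THICK limits (points at every depth) remain: the open
core of the stub.  All `[folklore]`.
-/

noncomputable section

namespace Summit.AtomisticToContinuum.Crystallization.Theorems.PerronTransitivityUniformBindingRigidity

open scoped BigOperators Topology
open Filter Set Metric
open Literature.MathematicalPhysics.StatisticalMechanics
open Summit.AtomisticToContinuum.Crystallization.Theorems.ChargedEnergyGapNegative (E3 eStar)
open Summit.AtomisticToContinuum.Crystallization.Theorems.HullBulkOptimal (ncard_ball_le)

/-! ## §11 Windows are finite and at most cubic; no uniformly bound slab -/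

section Slab

variable {Y : Set E3} {u : E3} {T : ℝ}

/-- `‖q‖ ≤ ‖q − ⟪q,u⟫u‖ + |⟪q,u⟫|` (`‖u‖ = 1`). [folklore] -/
theorem norm_le_lateral_add (hu : ‖u‖ = 1) (q : E3) :
    ‖q‖ ≤ ‖q - inner ℝ q u • u‖ + |inner ℝ q u| := by
  have h : q = (q - inner ℝ q u • u) + inner ℝ q u • u := by abel
  calc ‖q‖ = ‖(q - inner ℝ q u • u) + inner ℝ q u • u‖ := by rw [← h]
    _ ≤ ‖q - inner ℝ q u • u‖ + ‖inner ℝ q u • u‖ := norm_add_le _ _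
    _ = ‖q - inner ℝ q u • u‖ + |inner ℝ q u| := by rw [norm_smul, Real.norm_eq_abs, hu, mul_one]

/-- Windows of a separated slab are finite: `W_L ⊆ closedBall 0 (L + T)`. [folklore] -/
theorem finite_window (hu : ‖u‖ = 1) (hsep : ∀ p ∈ Y, ∀ q ∈ Y, p ≠ q → 1 / 4 ≤ dist p q)
    (hslab : ∀ q ∈ Y, -T ≤ inner ℝ q u ∧ inner ℝ q u ≤ 0) (L : ℝ) :
    ({q : E3 | q ∈ Y ∧ ‖q - inner ℝ q u • u‖ ≤ L} : Set E3).Finite := by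
  refine (finite_sep_ball (by norm_num : (0 : ℝ) < 1 / 4) hsep 0 (L + T)).subset ?_
  rintro q ⟨hq, hqL⟩
  refine ⟨hq, ?_⟩
  rw [dist_zero_right]
  have h1 := norm_le_lateral_add hu q
  have h2 : |inner ℝ q u| ≤ T := by
    rw [abs_le]; constructor <;> linarith [(hslab q hq).1, (hslab q hq).2]
  linarith

/-- **Cubic packing bound for windows**: `#W_L ≤ (8(L+T) + 1)³` (`W_L ⊆ closedBall 0 (L+T)` and the
tree's `ncard_ball_le` at separation `1/4`). [folklore] -/
theorem card_window_le (hu : ‖u‖ = 1) (hsep : ∀ p ∈ Y, ∀ q ∈ Y, p ≠ q → 1 / 4 ≤ dist p q)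
    (hslab : ∀ q ∈ Y, -T ≤ inner ℝ q u ∧ inner ℝ q u ≤ 0) (hT : 0 ≤ T) {L : ℝ} (hL : 0 ≤ L)
    (W : Finset E3) (hW : ∀ q, q ∈ W ↔ q ∈ Y ∧ ‖q - inner ℝ q u • u‖ ≤ L) :
    (W.card : ℝ) ≤ (8 * (L + T) + 1) ^ 3 := by
  have h4 : (0 : ℝ) < 1 / 4 := by norm_num
  have hsub : ∀ q ∈ W, q ∈ ({q : E3 | q ∈ Y ∧ dist q 0 ≤ L + T} : Set E3) := by
    intro q hq
    have hq' := (hW q).1 hq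
    refine ⟨hq'.1, ?_⟩
    rw [dist_zero_right]
    have h1 := norm_le_lateral_add hu q
    have h2 : |inner ℝ q u| ≤ T := by
      rw [abs_le]; constructor <;> linarith [(hslab q hq'.1).1, (hslab q hq'.1).2]
    linarith
  have hfin := finite_sep_ball h4 hsep (0 : E3) (L + T)
  have h1 : (W.card : ℝ) ≤ (({q : E3 | q ∈ Y ∧ dist q 0 ≤ L + T} : Set E3).ncard : ℝ) := by
    have : W.card ≤ hfin.toFinset.card :=
      Finset.card_le_card fun q hq => hfin.mem_toFinset.2 (hsub q hq)
    rw [Set.ncard_eq_toFinset_card _ hfin]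
    exact_mod_cast this
  have h2 := ncard_ball_le h4 hsep (0 : E3) (show (0 : ℝ) ≤ L + T by linarith)
  rw [show (2 * (L + T) / (1 / 4) + 1 : ℝ) = 8 * (L + T) + 1 by ring] at h2
  exact h1.trans h2

/-- **No uniformly bound slab** (the thin case of `(NHB)`): a `1/4`-separated `Y ⊆ ℝ³` containing
`0` and contained in a slab `{−T ≤ ⟪q, u⟫ ≤ 0}` (`‖u‖ = 1`) has a site whose Lennard-Jones site sum
exceeds `2e*` (exponential growth of the windows from the window inequality of part V, against the
cubic packing bound). [folklore] -/
theorem noSlabBinding (hu : ‖u‖ = 1) (h0 : (0 : E3) ∈ Y)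
    (hsep : ∀ p ∈ Y, ∀ q ∈ Y, p ≠ q → 1 / 4 ≤ dist p q)
    (hslab : ∀ q ∈ Y, -T ≤ inner ℝ q u ∧ inner ℝ q u ≤ 0) :
    ∃ p ∈ Y, 2 * eStar < ∑' q : {q : E3 // q ∈ Y ∧ q ≠ p}, lennardJones (dist p q.1) := by
  classical
  by_contra hall
  push Not at hall
  have hT : 0 ≤ T := by
    have := (hslab 0 h0).1
    rw [inner_zero_left] at this
    linarith
  -- the gain per site and the scales
  set g : ℝ := -lennardJones (T + 2) with hg
  have hg0 : 0 < g := by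
    have := lennardJones_neg (show (1 : ℝ) < T + 2 by linarith)
    rw [hg]; linarith
  have hg1 : g ≤ 1 / 12 := by
    have := neg_one_div_le_lennardJones (T + 2)
    rw [hg]; linarith
  set D : ℝ := max 1 (21846 / g) with hD
  have hD1 : 1 ≤ D := le_max_left _ _
  have hDg : 21846 / g ≤ D := le_max_right _ _
  have hD4 : 1 / 4 ≤ D := by linarith
  set κ : ℝ := g / 1398102 with hκ
  have hκ0 : 0 < κ := by positivity
  have hκ1 : κ < 1 := by
    rw [hκ, div_lt_one (by norm_num)]; linarith
  -- windows as finsets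
  have hfin := fun L : ℝ => finite_window hu hsep hslab L
  set Wf : ℝ → Finset E3 := fun L => (hfin L).toFinset with hWf
  have hWmem : ∀ L q, q ∈ Wf L ↔ q ∈ Y ∧ ‖q - inner ℝ q u • u‖ ≤ L := fun L q => by
    rw [hWf]; exact (hfin L).mem_toFinset
  -- the window inequality at scale `D`: `#W_{L-D} ≤ (1 - κ) #W_L`
  have hstep : ∀ L : ℝ, ((Wf (L - D)).card : ℝ) ≤ (1 - κ) * (Wf L).card := by
    intro L
    have h := slab_window_ineq hu hT hsep hslab hall hD4 (Wf L) (Wf (L - D)) (hWmem L)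
      (hWmem (L - D))
    have hD3 : 10923 / D ^ 3 ≤ g / 2 := by
      have hDD : D ≤ D ^ 3 := by
        calc D = D * 1 * 1 := by ring
          _ ≤ D * D * D := by gcongr
          _ = D ^ 3 := by ring
      have h1 : 21846 ≤ g * D := by rw [div_le_iff₀ hg0] at hDg; linarith
      rw [div_le_iff₀ (by positivity)]
      nlinarith
    have hNL : (0 : ℝ) ≤ (Wf L).card := Nat.cast_nonneg _
    have h1 := mul_le_mul_of_nonneg_right hD3 hNL
    have h2 : g / 2 * (Wf L).card ≤ 699051 * (((Wf L).card : ℝ) - (Wf (L - D)).card) := by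
      rw [← hg] at h; linarith
    rw [hκ]
    rw [show (1 - g / 1398102) * ((Wf L).card : ℝ) =
      (699051 * (Wf L).card - g / 2 * (Wf L).card) / 699051 by ring]
    rw [le_div_iff₀ (by norm_num)]
    linarith
  -- exponential growth: `(1-κ)^k · #W_{D + kD} ≥ 1`
  have hN0 : (1 : ℝ) ≤ (Wf D).card := by
    have hmem : (0 : E3) ∈ Wf D :=
      (hWmem D 0).2 ⟨h0, by rw [inner_zero_left, zero_smul, sub_zero, norm_zero]; linarith⟩
    have : 1 ≤ (Wf D).card := Finset.card_pos.2 ⟨0, hmem⟩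
    exact_mod_cast this
  have hgrow : ∀ k : ℕ, (1 : ℝ) ≤ (1 - κ) ^ k * (Wf (D + k * D)).card := by
    intro k
    induction k with
    | zero => simpa using hN0
    | succ k ih =>
      have hs := hstep (D + ((k + 1 : ℕ) : ℝ) * D)
      have he : D + ((k + 1 : ℕ) : ℝ) * D - D = D + (k : ℝ) * D := by push_cast; ring
      rw [he] at hs
      have hpow : 0 ≤ (1 - κ) ^ k := pow_nonneg (by linarith) k
      calc (1 : ℝ) ≤ (1 - κ) ^ k * (Wf (D + k * D)).card := ih
        _ ≤ (1 - κ) ^ k * ((1 - κ) * (Wf (D + ((k + 1 : ℕ) : ℝ) * D)).card) :=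
            mul_le_mul_of_nonneg_left hs hpow
        _ = (1 - κ) ^ (k + 1) * (Wf (D + ((k + 1 : ℕ) : ℝ) * D)).card := by rw [pow_succ]; ring
  -- the cubic bound
  set A : ℝ := 8 * D + 8 * T + 1 with hA
  have hA0 : 0 < A := by positivity
  have hcub : ∀ k : ℕ, ((Wf (D + k * D)).card : ℝ) ≤ A ^ 3 * ((k : ℝ) + 1) ^ 3 := by
    intro k
    have hk0 : (0 : ℝ) ≤ k := Nat.cast_nonneg k
    have hL0 : 0 ≤ D + k * D := by positivity
    have h1 := card_window_le hu hsep hslab hT hL0 (Wf (D + k * D)) (hWmem _)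
    have h2 : 8 * (D + k * D + T) + 1 ≤ A * (k + 1) := by rw [hA]; nlinarith
    have h3 : (8 * (D + ↑k * D + T) + 1) ^ 3 ≤ (A * (k + 1)) ^ 3 :=
      pow_le_pow_left₀ (by positivity) h2 3
    calc ((Wf (D + k * D)).card : ℝ) ≤ (8 * (D + k * D + T) + 1) ^ 3 := h1
      _ ≤ (A * (k + 1)) ^ 3 := h3
      _ = A ^ 3 * ((k : ℝ) + 1) ^ 3 := by ring
  -- `(k+1)³ (1-κ)^k → 0`
  have hlim : Tendsto (fun k : ℕ => A ^ 3 * (((k : ℝ) + 1) ^ 3 * (1 - κ) ^ k)) atTop (𝓝 0) := by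
    have hne : (1 - κ) ≠ 0 := ne_of_gt (by linarith)
    have h1 := tendsto_pow_const_mul_const_pow_of_lt_one 3
      (show (0 : ℝ) ≤ 1 - κ by linarith) (by linarith : 1 - κ < 1)
    have h2 := (h1.comp (tendsto_add_atTop_nat 1)).const_mul ((1 - κ)⁻¹)
    have h3 := h2.const_mul (A ^ 3)
    simp only [mul_zero] at h3
    refine h3.congr fun k => ?_
    simp only [Function.comp]
    push_cast
    field_simp
    ring
  have hev := (Metric.tendsto_nhds.1 hlim) 1 one_pos
  obtain ⟨k, hk⟩ := hev.exists
  rw [Real.dist_eq, sub_zero, abs_lt] at hk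
  have hpow : 0 ≤ (1 - κ) ^ k := pow_nonneg (by linarith) k
  have h1 := hgrow k
  have h2 := mul_le_mul_of_nonneg_left (hcub k) hpow
  nlinarith

/-! ## Registered sub-goal of `stub_cohesion`: no uniformly bound slab -/

/-- **Sub-goal `stub_cohesion_noSlabBinding` of the stub `stub_cohesion`** (registered on
stmt-AtomisticToContinuum-15099): the thin case of `(NHB)` (`noSlabBinding` in arrow form, with
`e* = ⨅_Q e(Q)` unfolded). [folklore] -/
theorem stub_cohesion_noSlabBinding :
    ∀ (Y : Set (EuclideanSpace ℝ (Fin 3))) (u : EuclideanSpace ℝ (Fin 3)) (T : ℝ), ‖u‖ = 1 →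
      (0 : EuclideanSpace ℝ (Fin 3)) ∈ Y →
      (∀ p ∈ Y, ∀ q ∈ Y, p ≠ q → 1 / 4 ≤ dist p q) →
      (∀ q ∈ Y, -T ≤ inner ℝ q u ∧ inner ℝ q u ≤ 0) →
      ∃ p ∈ Y, 2 * (⨅ Q : PeriodicConfiguration 3, Q.energyPerParticle lennardJones) <
        ∑' q : {q : EuclideanSpace ℝ (Fin 3) // q ∈ Y ∧ q ≠ p}, lennardJones (dist p q.1) :=
  fun _ _ _ hu h0 hsep hslab => noSlabBinding hu h0 hsep hslab

end Slab

end Summit.AtomisticToContinuum.Crystallization.Theorems.PerronTransitivityUniformBindingRigidity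

end
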